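import Summits.NavierStokesRegularity.NavierStokesRegularity.Theorems.HodographBetchovFastClassSqueezeTopSingularNull
import Literature.Analysis.FluidPDE.RusinSverakGaugePatching

/-!
# `NoFastEnergyConcentration` (stmt-NavierStokesRegularity-18118), line `morrey-nullset`:
# a Morrey-bounded energy does not concentrate on the `ℋ¹`-null top singular set

Piece X₁ of the BC2 split of crux `FastClassSqueeze` (stmt-NavierStokesRegularity-15832) of route
`HodographBetchov`, registered skeleton `Cruxes/FastClassSqueeze/Lines/pieceX1_morrey_nullset.lean`,
stub 2 `stub_tightness_of_morrey` — the PROVABLE stub of the line (stub 1, the Type-I-in-space energy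
Morrey bound, is the open one).

**Statement.** For `ν, T > 0` and a classical solution `(u,p)` of unforced Navier–Stokes on `ℝ³ × [0,T)`
that is Leray–Hopf from a rapidly decaying datum: IF the energy Morrey bound
`∫_{B_r(x₀)} |u(t)|² ≤ C r` holds for all centres `x₀`, radii `r ∈ (0,r₀)` and times `t ∈ [0,T)` with
`T − r² < t`, THEN for every `ε > 0` there are an open `U ⊇ Σ_T(u) = {x | (T,x) is a backward singular
point of u}` and a time `τ < T` with `∫_U |u(t)|² ≤ ε` for all `t ∈ [0,T)`, `t > τ`.

**Proof.** `Σ_T(u)` is compact (`Germ.isCompact_topSingularSet`) and `ℋ¹`-null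
(`Germ.hausdorffMeasure_topSingularSet`, CKN Theorem B at the top slice).  The covering lemma
`exists_finset_ball_cover_of_hausdorffMeasure_one_eq_zero` (Carathéodory's construction unpacked from
Mathlib's `hausdorffMeasure_apply`, a geometric perturbation of the radii to make them positive, and a
finite subcover) gives finitely many balls `B(cₙ, ρₙ)`, `0 < ρₙ < r₀`, covering `Σ_T(u)` with
`Σ ρₙ ≤ ε / C'`, `C' = max C 0 + 1`.  Put `U = ⋃ B(cₙ, ρₙ)` and `τ = T − m²`, `m` the least radius: for
`t > τ` every ball is inside its Morrey window, so finite subadditivity of the set lower integral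
(`Literature.Analysis.FluidPDE.lintegral_biUnion_finset_le`) gives `∫_U |u(t)|² ≤ Σ C' ρₙ ≤ ε`.

No new definitions; all constants are tree / Mathlib declarations.  The two covering lemmas are generic
(metric spaces) and stated for reuse by the sibling germ lines.
-/

noncomputable section

-- the summit and its single problem share the name `NavierStokesRegularity` (D-0017 nested layout)
set_option linter.dupNamespace false

namespace Summit.NavierStokesRegularity.NavierStokesRegularity.Theorems.NoFastEnergyConcentration.MorreyNullset

open Set MeasureTheory Metric Literature.Analysis.FluidPDE
open Summit.NavierStokesRegularity.NavierStokesRegularity.Theorems.FastClassSqueeze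
open scoped ENNReal NNReal

/-! ### Covering lemmas -/

/-- **Covers extracted from `ℋ¹(A) = 0`.** If `μH[1] A = 0` then for every `r > 0` and `η > 0` there is
a countable cover of `A` by sets of extended diameter `≤ r` whose diameters sum to `< η` (Carathéodory's
construction, Mathlib's `hausdorffMeasure_apply`, with `diam^1 = diam` and empty pieces costing nothing).
[folklore] -/
theorem exists_cover_of_hausdorffMeasure_one_eq_zero {X : Type*} [EMetricSpace X] [MeasurableSpace X]
    [BorelSpace X] {A : Set X} (hH : μH[1] A = 0) {r η : ℝ≥0∞} (hr : 0 < r) (hη : 0 < η) :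
    ∃ t : ℕ → Set X, A ⊆ ⋃ n, t n ∧ (∀ n, ediam (t n) ≤ r) ∧ ∑' n, ediam (t n) < η := by
  have h0 : ⨅ (t : ℕ → Set X) (_ : A ⊆ ⋃ n, t n) (_ : ∀ n, ediam (t n) ≤ r),
      ∑' n, ⨆ _ : (t n).Nonempty, ediam (t n) ^ (1 : ℝ) ≤ 0 := by
    have h := Measure.hausdorffMeasure_apply (1 : ℝ) A
    rw [hH] at h
    calc ⨅ (t : ℕ → Set X) (_ : A ⊆ ⋃ n, t n) (_ : ∀ n, ediam (t n) ≤ r),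
          ∑' n, ⨆ _ : (t n).Nonempty, ediam (t n) ^ (1 : ℝ)
        ≤ ⨆ (r : ℝ≥0∞) (_ : 0 < r), ⨅ (t : ℕ → Set X) (_ : A ⊆ ⋃ n, t n)
            (_ : ∀ n, ediam (t n) ≤ r), ∑' n, ⨆ _ : (t n).Nonempty, ediam (t n) ^ (1 : ℝ) :=
          le_iSup₂ (f := fun (r : ℝ≥0∞) (_ : 0 < r) => ⨅ (t : ℕ → Set X) (_ : A ⊆ ⋃ n, t n)
            (_ : ∀ n, ediam (t n) ≤ r), ∑' n, ⨆ _ : (t n).Nonempty, ediam (t n) ^ (1 : ℝ)) r hr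
      _ = 0 := h.symm
  obtain ⟨t, ht⟩ := iInf_lt_iff.1 (lt_of_le_of_lt h0 hη)
  obtain ⟨hA, ht⟩ := iInf_lt_iff.1 ht
  obtain ⟨hd, ht⟩ := iInf_lt_iff.1 ht
  refine ⟨t, hA, hd, ?_⟩
  calc ∑' n, ediam (t n) = ∑' n, ⨆ _ : (t n).Nonempty, ediam (t n) ^ (1 : ℝ) := by
        refine tsum_congr fun n => ?_
        by_cases h : (t n).Nonempty
        · rw [iSup_pos h, ENNReal.rpow_one]
        · rw [iSup_neg h, Set.not_nonempty_iff_eq_empty.1 h, ediam_empty, ENNReal.bot_eq_zero]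
    _ < η := ht

/-- **Finite ball covers of a compact `ℋ¹`-null set with small radius sum.** If `K` is compact with
`μH[1] K = 0`, then for all `r₀, δ > 0` there are finitely many balls `B(cₙ, ρₙ)` with `0 < ρₙ < r₀`
covering `K` and `Σ ρₙ ≤ δ`: take a countable cover by sets `tₙ` of diameter `≤ r₀/2` with
`Σ diam tₙ < δ/2`, centre a ball at a point of each nonempty `tₙ` with radius
`diam tₙ + κ/2^{n+1}`, `κ = min(δ, r₀)/2`, and pass to a finite subcover. [folklore] -/
theorem exists_finset_ball_cover_of_hausdorffMeasure_one_eq_zero {X : Type*} [MetricSpace X]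
    [MeasurableSpace X] [BorelSpace X] [Nonempty X] {K : Set X} (hK : IsCompact K)
    (hH : μH[1] K = 0) {r₀ δ : ℝ} (hr₀ : 0 < r₀) (hδ : 0 < δ) :
    ∃ (ι : Finset ℕ) (c : ℕ → X) (ρ : ℕ → ℝ), (∀ n, 0 < ρ n) ∧ (∀ n, ρ n < r₀) ∧
      K ⊆ ⋃ n ∈ ι, ball (c n) (ρ n) ∧ ∑ n ∈ ι, ρ n ≤ δ := by
  classical
  obtain ⟨t, hKt, hdiam, htsum⟩ := exists_cover_of_hausdorffMeasure_one_eq_zero hH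
    (r := ENNReal.ofReal (r₀ / 2)) (η := ENNReal.ofReal (δ / 2))
    (ENNReal.ofReal_pos.2 (by positivity)) (ENNReal.ofReal_pos.2 (by positivity))
  -- the perturbation scale
  set κ : ℝ := min δ r₀ / 2 with hκ
  have hκpos : 0 < κ := by positivity
  have hκδ : κ ≤ δ / 2 := div_le_div_of_nonneg_right (min_le_left _ _) (by norm_num)
  have hκr : κ ≤ r₀ / 2 := div_le_div_of_nonneg_right (min_le_right _ _) (by norm_num)
  -- real diameters, perturbations, centres, radii
  set d : ℕ → ℝ := fun n => (ediam (t n)).toReal with hd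
  set e : ℕ → ℝ := fun n => κ / 2 / 2 ^ n with he
  have hne_top : ∀ n, ediam (t n) ≠ ∞ := fun n =>
    ne_top_of_le_ne_top ENNReal.ofReal_ne_top (hdiam n)
  have hd_le : ∀ n, d n ≤ r₀ / 2 := fun n =>
    ENNReal.toReal_le_of_le_ofReal (by positivity) (hdiam n)
  have hd_nn : ∀ n, 0 ≤ d n := fun n => ENNReal.toReal_nonneg
  have he_pos : ∀ n, 0 < e n := fun n => by positivity
  have he_le : ∀ n, e n ≤ κ / 2 := fun n =>
    div_le_self (by positivity) (one_le_pow₀ (by norm_num))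
  set c : ℕ → X := fun n => if h : (t n).Nonempty then h.some else Classical.arbitrary X with hc
  set ρ : ℕ → ℝ := fun n => d n + e n with hρ
  have hρpos : ∀ n, 0 < ρ n := fun n => add_pos_of_nonneg_of_pos (hd_nn n) (he_pos n)
  have hρlt : ∀ n, ρ n < r₀ := fun n => by
    have h1 := hd_le n
    have h2 := he_le n
    show d n + e n < r₀
    linarith
  -- the balls cover `K`
  have hcover : K ⊆ ⋃ n, ball (c n) (ρ n) := by
    intro x hx
    obtain ⟨n, hn⟩ := mem_iUnion.1 (hKt hx)
    have hne : (t n).Nonempty := ⟨x, hn⟩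
    have hcn : c n ∈ t n := by
      show (if h : (t n).Nonempty then h.some else Classical.arbitrary X) ∈ t n
      rw [dif_pos hne]
      exact hne.some_mem
    refine mem_iUnion.2 ⟨n, mem_ball.2 ?_⟩
    calc dist x (c n) = (edist x (c n)).toReal := dist_edist x (c n)
      _ ≤ d n := ENNReal.toReal_mono (hne_top n) (edist_le_ediam_of_mem hn hcn)
      _ < d n + e n := lt_add_of_pos_right _ (he_pos n)
  obtain ⟨ι, hι⟩ := hK.elim_finite_subcover (fun n => ball (c n) (ρ n)) (fun _ => isOpen_ball) hcover
  refine ⟨ι, c, ρ, hρpos, hρlt, hι, ?_⟩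
  -- the radius sum
  have hsum_d : ∑ n ∈ ι, d n ≤ δ / 2 := by
    have h1 : ∑ n ∈ ι, ediam (t n) ≤ ENNReal.ofReal (δ / 2) :=
      (ENNReal.sum_le_tsum ι).trans htsum.le
    have h2 : (∑ n ∈ ι, ediam (t n)).toReal = ∑ n ∈ ι, d n :=
      ENNReal.toReal_sum fun n _ => hne_top n
    rw [← h2]
    exact ENNReal.toReal_le_of_le_ofReal (by positivity) h1
  have hsum_e : ∑ n ∈ ι, e n ≤ κ := by
    have h := (summable_geometric_two' κ).sum_le_tsum ι (fun n _ => (he_pos n).le)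
    rwa [tsum_geometric_two'] at h
  calc ∑ n ∈ ι, ρ n = ∑ n ∈ ι, d n + ∑ n ∈ ι, e n := Finset.sum_add_distrib
    _ ≤ δ / 2 + κ := add_le_add hsum_d hsum_e
    _ ≤ δ := by linarith

/-! ### The stub -/

/-- **Stub 2 of line `morrey-nullset` — a Morrey-bounded energy does not concentrate on the `ℋ¹`-null
top singular set.** Along every classical solution of unforced Navier–Stokes on `ℝ³ × [0,T)` that is
Leray–Hopf from a rapidly decaying datum: if the energy Morrey bound `∫_{B_r(x₀)} |u(t)|² ≤ C r` holds
for all centres, all radii `r ∈ (0,r₀)` and all `t ∈ [0,T)` with `T − r² < t`, then for every `ε > 0`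
there are an open `U ⊇ Σ_T(u)` and a time `τ < T` with `∫_U |u(t,x)|² dx ≤ ε` for all `t ∈ [0,T)`,
`t > τ` (finite cover of the compact `ℋ¹`-null set `Σ_T(u)` by balls of radii `ρₙ < r₀` with
`Σ ρₙ ≤ ε/C'`, `U` their union, `τ = T − (min ρₙ)²`, finite subadditivity of the set integral).
[cite: CKN1982, Thm. B] [cite: Tsai1998, Lemma 4.2] -/
theorem stub_tightness_of_morrey :
    ∀ (ν T : ℝ), 0 < ν → 0 < T →
      ∀ (u : ℝ → EuclideanSpace ℝ (Fin 3) → EuclideanSpace ℝ (Fin 3)) (p : ℝ → EuclideanSpace ℝ (Fin 3) → ℝ),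
      Literature.Analysis.FluidPDE.IsClassicalNSSolutionOn (Set.Ico 0 T) ν 0 u p →
      Literature.Analysis.FluidPDE.IsLerayHopfOn T ν 0 (u 0) u →
      Literature.Analysis.FluidPDE.HasRapidSpatialDecay (u 0) →
      (∃ C r₀ : ℝ, 0 < r₀ ∧ ∀ x₀ : EuclideanSpace ℝ (Fin 3), ∀ r ∈ Set.Ioo 0 r₀, ∀ t ∈ Set.Ico 0 T,
        T - r ^ 2 < t → ∫⁻ x in Metric.ball x₀ r, ‖u t x‖ₑ ^ 2 ≤ ENNReal.ofReal (C * r)) →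
      ∀ ε : ℝ, 0 < ε → ∃ U : Set (EuclideanSpace ℝ (Fin 3)), IsOpen U ∧
        {x : EuclideanSpace ℝ (Fin 3) | Literature.Analysis.FluidPDE.IsBackwardSingularPoint u (T, x)} ⊆ U ∧
        ∃ τ : ℝ, τ < T ∧ ∀ t ∈ Set.Ico 0 T, τ < t →
          ∫⁻ x in U, ‖u t x‖ₑ ^ 2 ≤ ENNReal.ofReal ε := by
  intro ν T hν hT u p hcl hLH hdec hMorrey ε hε
  classical
  obtain ⟨C, r₀, hr₀, hM⟩ := hMorrey
  -- a positive Morrey constant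
  set C' : ℝ := max C 0 + 1 with hC'
  have hC'pos : 0 < C' := by positivity
  have hCC' : C ≤ C' := by
    have := le_max_left C 0
    show C ≤ max C 0 + 1
    linarith
  -- the compact `ℋ¹`-null top singular set and its finite ball cover
  have hK := Germ.isCompact_topSingularSet hν hT hcl hLH hdec
  have hH := Germ.hausdorffMeasure_topSingularSet hν hT hcl hLH hdec
  obtain ⟨ι, c, ρ, hρpos, hρlt, hcov, hsum⟩ :=
    exists_finset_ball_cover_of_hausdorffMeasure_one_eq_zero hK hH hr₀ (div_pos hε hC'pos)
  refine ⟨⋃ n ∈ ι, ball (c n) (ρ n), isOpen_biUnion fun _ _ => isOpen_ball, hcov, ?_⟩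
  -- the least radius (`r₀` inserted to make the finset nonempty)
  set m : ℝ := (insert r₀ (ι.image ρ)).min' (Finset.insert_nonempty _ _) with hm
  have hmpos : 0 < m := by
    refine (Finset.lt_min'_iff _ _).2 fun y hy => ?_
    rcases Finset.mem_insert.1 hy with rfl | hy
    · exact hr₀
    · obtain ⟨n, -, rfl⟩ := Finset.mem_image.1 hy
      exact hρpos n
  have hmle : ∀ n ∈ ι, m ≤ ρ n := fun n hn =>
    Finset.min'_le _ _ (Finset.mem_insert_of_mem (Finset.mem_image_of_mem ρ hn))
  refine ⟨T - m ^ 2, by nlinarith, fun t ht hτt => ?_⟩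
  calc ∫⁻ x in ⋃ n ∈ ι, ball (c n) (ρ n), ‖u t x‖ₑ ^ 2
      ≤ ∑ n ∈ ι, ∫⁻ x in ball (c n) (ρ n), ‖u t x‖ₑ ^ 2 := lintegral_biUnion_finset_le _ _ _ _
    _ ≤ ∑ n ∈ ι, ENNReal.ofReal (C' * ρ n) := by
        refine Finset.sum_le_sum fun n hn => ?_
        have h1 : T - ρ n ^ 2 < t := by
          have : m ^ 2 ≤ ρ n ^ 2 := pow_le_pow_left₀ hmpos.le (hmle n hn) 2
          linarith
        exact (hM (c n) (ρ n) ⟨hρpos n, hρlt n⟩ t ht h1).trans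
          (ENNReal.ofReal_le_ofReal (mul_le_mul_of_nonneg_right hCC' (hρpos n).le))
    _ = ENNReal.ofReal (∑ n ∈ ι, C' * ρ n) :=
        (ENNReal.ofReal_sum_of_nonneg fun n _ => mul_nonneg hC'pos.le (hρpos n).le).symm
    _ ≤ ENNReal.ofReal ε := by
        refine ENNReal.ofReal_le_ofReal ?_
        rw [← Finset.mul_sum]
        calc C' * ∑ n ∈ ι, ρ n ≤ C' * (ε / C') := mul_le_mul_of_nonneg_left hsum hC'pos.le
          _ = ε := by field_simp

end Summit.NavierStokesRegularity.NavierStokesRegularity.Theorems.NoFastEnergyConcentration.MorreyNullset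

end
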